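import Literature.MathematicalPhysics.QuantumFieldTheory.Federbush1986.BallSmoothingDeriv
import Literature.MathematicalPhysics.QuantumFieldTheory.Federbush1986.PhaseCellIVThmA34Repaired

/-!
# `Federbush1986.PhaseCellIVThmA3Retract` — [Federbush1988PhaseCellIV] Appendix A, **Theorem A.3** (A.25)–(A.26) p. 342 with
# the p. 339 «Caution» cap (decl of record `PhaseCellIVAppA.ThmA3ContCap`, p251889) — PROVED for every target `M ⊆ R^t` that is a
# uniform smooth neighbourhood retract (the output of the tubular-neighbourhood theorem for print's compact `C^∞` submanifolds),
# by the printed proof (A.27)–(A.31): `f^s = Pr_M ∘ f^{s′}`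

statement-level skeleton of published theorems with citation tags; proofs where landed; nothing here is a claim about the Yang–Mills mass gap

CITATION HEADER.  P. Federbush, *A phase cell approach to Yang–Mills theory. IV. The choice of variables*, Commun. Math.
Phys. **114** (1988) 317–343 [Federbush1988PhaseCellIV], Appendix A part C «Geometric Construction 5», Theorem A.3 and its
proof p. 342; «Caution» p. 339 (renders f4-p023/p026 of unit `lit-balaban-r19`).  Cell `lit-balaban`, Phase-2 proof seat
**p04 gen 7**; SKELETON row **F4.ThmA.3** (decl of record `PhaseCellIVAppA.ThmA3ContCap`, `PhaseCellIVThmA34Repaired` §3,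
p251889 ACCEPTED c0843a665edd; fold owner r19, `ROWS-F4.md` v1.3).  Inputs BY NAME: `LipschitzMollifier` (p258818),
`BallCutoffs`, `BallSmoothing` (`smooth`, `continuous_smooth`, `contDiffOn_smooth`, `norm_smooth_sub_le'`, `smooth_eq_on_sphere`),
`BallSmoothingDeriv` (`exists_deriv_bound`), Mathlib `LipschitzOnWith.extend_finite_dimension`, `norm_iteratedFDerivWithin_comp_le`.

WHAT IS PRINTED (p. 342, verbatim).  «THEOREM A.3. There is a mapping `f^s : B → M`, such that a) `f^s|_{∂B} = f|_{∂B}` (A.25),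
b) `|D^α f^s(x)| ≤ c_α (d(x, ∂B))^{−(|α|−1)} Λ₁(f)` (A.26).  We now embed `M` in some Euclidean space `R^t`, and view `f` as a
map from `B` into `R^t`.  We pick a smoothing function `w` … (A.27)–(A.29) … Let `f^{s′}_ε(x) = ∫ w^{εd(x)}(x − y) f(y) dy`
(A.30) and `f^s_ε(x) = Pr_M(f^{s′}_ε(x))` (A.31), where `Pr_M` is the projection onto `M`, using the normal bundle to `M`, and
defined in a neighborhood of `M`.  It is easy to show that for `ε` small enough (A.31) is defined and satisfies the theorem.»
And p. 339: «Caution. The geometric theorems of Appendix A, require a universal bound on `Λ₁` of `φ`'s».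

WHAT THIS FILE PROVES.  `thmA3ContCap_of_retract`: **`ThmA3ContCap n t M` holds for every `n` and every `M ⊆ R^t` admitting a
uniform smooth retraction** — a `C^∞` map `P : R^t → R^t` and `r > 0` with `P(y) ∈ M` whenever `d(y, M) < r`, `P = id` on `M`,
and each `‖D^iP‖` bounded on `{d(·, M) < r}`.  These four hypotheses are exactly what print's sentence «`Pr_M` is the
projection onto `M`, using the normal bundle to `M`, and defined in a neighborhood of `M`» supplies for a COMPACT `C^∞`
SUBMANIFOLD of `R^t` (tubular-neighbourhood theorem; e.g. J. M. Lee, *Introduction to Smooth Manifolds*, 2nd ed., Thm. 6.24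
and Prop. 6.25: a tubular neighbourhood `U ⊇ M` and a smooth retraction `U → M`; shrink to a uniform `r`-neighbourhood by
compactness and cut `P` off smoothly outside).  The tubular-neighbourhood theorem itself is not in Mathlib and is NOT
asserted here: it is the hypothesis, carried openly; the companion `PhaseCellIVThmA3Sphere` DISCHARGES it for the model
targets `M = S^{t−1}` (`G = SU(2) = S³ ⊂ ℍ = R⁴`, `U(1) = S¹ ⊂ R²`) with the explicit normal projection `y ↦ y/|y|`.
PROOF (print's, step by step): extend `f : B → M ⊂ R^t` to a Lipschitz `ḡ : ℝⁿ → R^t` (constant `L_t·Λ₁(f)`, Mathlib's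
finite-dimensional Kirszbraun substitute — the factor `L_t` joins the `c_α`); `f^{s′} := smooth ε ḡ` with `ε = ε(c₁, r)` so small
that `‖f^{s′} − f‖ ≤ 4εL_tΛ₁ < r` on `B` («for `ε` small enough (A.31) is defined») and `ε ≤ 1/4` (then `f^{s′}` on `B` only sees
`f`); `f^s := P ∘ f^{s′}`; (A.25) from `f^{s′} = f` on `∂B` and `P = id` on `M`; continuity/smoothness by composition; (A.26) from
`BallSmoothingDeriv.exists_deriv_bound` and the chain-rule bound `norm_iteratedFDerivWithin_comp_le` with the weight
`D = θ(x)^{−1}·ρ`, `ρ^i ≥ A·L_tΛ₁θ(x)` (`ρ = u^{1/m}` or `u`), which keeps ONE factor `Λ₁(f)` — this is where the cap `Λ₁ ≤ c₁`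
enters the constants, as the «Caution» says.

WHAT THIS MODULE PROVIDES (namespace `PhaseCellIVAppA.Retract`): theorems `moll_congr`, `smooth_congr_of_eqOn`,
`smooth_eventuallyEq_of_eqOn`, `exists_root_scale`, `norm_iteratedFDeriv_comp_le_of_scale`, `exists_lipschitz_extension`,
`iteratedFDeriv_eq_zero_of_sphere_empty`, **`thmA3ContCap_of_retract`**; no definitions, no named facts; axioms standard.
-/

namespace Literature.MathematicalPhysics.QuantumFieldTheory.Federbush1986

noncomputable section

open MeasureTheory Metric Set Filter Function
open scoped ContDiff Topology NNReal Convolution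

namespace PhaseCellIVAppA

namespace Retract

open LipschitzMollifier BallCutoffs BallSmoothing

variable {n t : ℕ}

/-! ## §1 Locality: on the ball, `f^{s′}` only sees `f` (for `ε ≤ 1/4`) -/

/-- The mollifier at `x` only sees `g` on `B̄(x, h)`. [cite: Federbush1988PhaseCellIV, (A.27) c), (A.30) p. 342] -/
theorem moll_congr {g₁ g₂ : Euc n → Euc t} {h : ℝ} (hh : 0 < h) {x : Euc n}
    (heq : ∀ y ∈ closedBall x h, g₁ y = g₂ y) : moll g₁ h x = moll g₂ h x := by
  unfold moll
  simp only [convolution_def, ContinuousLinearMap.lsmul_apply]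
  refine integral_congr_ae (Eventually.of_forall fun s => ?_)
  by_cases hs : s ∈ closedBall (0 : Euc n) 1
  · have hmem : h • (h⁻¹ • x - s) ∈ closedBall x h := by
      rw [mem_closedBall, dist_zero_right] at hs
      rw [mem_closedBall, dist_eq_norm, smul_sub, smul_smul, mul_inv_cancel₀ hh.ne', one_smul, sub_sub_cancel_left, norm_neg,
        norm_smul, Real.norm_eq_abs, abs_of_pos hh]
      exact mul_le_of_le_one_right hh.le hs
    simp only [heq _ hmem]
  · simp only [kernel_eq_zero hs, zero_smul]

/-- A live cutoff at `x` forces `h_j < 2εθ(x)`. [cite: Federbush1988PhaseCellIV, (A.30) p. 342] -/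
theorem hs_lt_of_psi_ne_zero {ε : ℝ} (hε : 0 < ε) {j : ℕ} {x : Euc n} (hψ : psi j x ≠ 0) : hs ε j < 2 * ε * theta x := by
  have h1 : ¬ (2 : ℝ) ^ (j + 1) * theta x ≤ 1 := fun h => hψ (psi_eq_zero_of_le h)
  rw [not_le] at h1
  have h2 : (1 / 2 : ℝ) ^ j * 2 ^ (j + 1) = 2 := by rw [pow_succ, ← mul_assoc, ← mul_pow]; norm_num
  unfold hs
  have h3 : (1 / 2 : ℝ) ^ j < 2 * theta x := by
    have := mul_lt_mul_of_pos_left h1 (by positivity : (0 : ℝ) < (1 / 2) ^ j)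
    rw [mul_one, ← mul_assoc, h2] at this
    exact this
  nlinarith

/-- **Locality.** For `ε ≤ 1/4`, if `g₁ = g₂` on the closed unit ball then `smooth ε g₁ = smooth ε g₂` on the closed unit ball
(every live mollification radius `h_j < 2εθ(x) ≤ 4ε(1 − |x|) ≤ 1 − |x|` stays inside `B`). [cite: Federbush1988PhaseCellIV,
(A.30) p. 342] -/
theorem smooth_congr_of_eqOn {ε : ℝ} (hε : 0 < ε) (hε4 : ε ≤ 1 / 4) {g₁ g₂ : Euc n → Euc t}
    (heq : EqOn g₁ g₂ (closedBall (0 : Euc n) 1)) {x : Euc n} (hx : x ∈ closedBall (0 : Euc n) 1) :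
    smooth ε g₁ x = smooth ε g₂ x := by
  unfold smooth
  rw [heq hx]
  congr 1
  refine tsum_congr fun j => ?_
  by_cases hψ : psi j x = 0
  · rw [hψ, zero_smul, zero_smul]
  · congr 2
    refine moll_congr (hs_pos hε j) fun y hy => heq ?_
    rw [mem_closedBall, dist_zero_right]
    rw [mem_closedBall, dist_zero_right] at hx
    rw [mem_closedBall, dist_eq_norm] at hy
    have h1 := hs_lt_of_psi_ne_zero hε hψ
    have h2 := theta_le_two_mul x
    have h3 : ‖y‖ ≤ ‖y - x‖ + ‖x‖ := norm_le_norm_sub_add y x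
    nlinarith

/-- Hence for `x` in the OPEN ball `smooth ε g₁` and `smooth ε g₂` agree near `x` (all derivatives coincide).
[cite: Federbush1988PhaseCellIV, (A.30) p. 342] -/
theorem smooth_eventuallyEq_of_eqOn {ε : ℝ} (hε : 0 < ε) (hε4 : ε ≤ 1 / 4) {g₁ g₂ : Euc n → Euc t}
    (heq : EqOn g₁ g₂ (closedBall (0 : Euc n) 1)) {x : Euc n} (hx : x ∈ ball (0 : Euc n) 1) :
    smooth ε g₁ =ᶠ[𝓝 x] smooth ε g₂ := by
  filter_upwards [isOpen_ball.mem_nhds hx] with y hy using smooth_congr_of_eqOn hε hε4 heq (ball_subset_closedBall hy)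

/-! ## §2 The chain-rule bound with one surviving factor `Λ₁` -/

/-- The weight of the chain rule: for `0 ≤ u ≤ U`, `1 ≤ U`, `m ≥ 1` there is `ρ ≥ 0` with `u ≤ ρ^i` (`1 ≤ i ≤ m`) and
`ρ^m ≤ U^{m−1}u` (`ρ = u^{1/m}` if `u ≤ 1`, else `ρ = u`). [cite: Federbush1988PhaseCellIV, Theorem A.3 (A.26) p. 342] -/
theorem exists_root_scale {u U : ℝ} (hu : 0 ≤ u) (hU : u ≤ U) (hU1 : 1 ≤ U) {m : ℕ} (hm : 1 ≤ m) :
    ∃ ρ : ℝ, 0 ≤ ρ ∧ (∀ i, 1 ≤ i → i ≤ m → u ≤ ρ ^ i) ∧ ρ ^ m ≤ U ^ (m - 1) * u := by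
  have hUm : 1 ≤ U ^ (m - 1) := one_le_pow₀ hU1
  by_cases hu1 : u ≤ 1
  · refine ⟨u ^ ((1 : ℝ) / m), Real.rpow_nonneg hu _, fun i hi him => ?_, ?_⟩
    · rw [← Real.rpow_natCast, ← Real.rpow_mul hu]
      have hexp : (1 : ℝ) / m * i ≤ 1 := by
        rw [div_mul_eq_mul_div, one_mul, div_le_one (by exact_mod_cast hm)]; exact_mod_cast him
      have := Real.rpow_le_rpow_of_exponent_ge' hu hu1 (by positivity) hexp
      rwa [Real.rpow_one] at this
    · rw [← Real.rpow_natCast, ← Real.rpow_mul hu, one_div_mul_cancel (by exact_mod_cast (by omega : m ≠ 0)), Real.rpow_one]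
      exact le_mul_of_one_le_left hu hUm
  · rw [not_le] at hu1
    refine ⟨u, hu, fun i hi _ => le_self_pow₀ hu1.le (by omega), ?_⟩
    obtain ⟨k, rfl⟩ := Nat.exists_eq_add_of_le' hm
    rw [Nat.add_sub_cancel, pow_succ]
    exact mul_le_mul_of_nonneg_right (pow_le_pow_left₀ hu hU k) hu

/-- **Chain rule keeping one factor `Λ₁`.** If `Φ` is `C^∞` on an open set `s ∋ x` with `‖D^iΦ(x)‖ ≤ u·σ^{−i}` (`1 ≤ i ≤ m`,
`0 ≤ u ≤ U`, `U ≥ 1`, `σ > 0`) and `P` is `C^∞` with `‖D^iP(Φ(x))‖ ≤ C` (`i ≤ m`), then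
`‖D^m(P ∘ Φ)(x)‖ ≤ m!·C·U^{m−1}·u·σ^{−m}` — linear in `u` (here `u = AΛ₁θ`, `σ = θ`).
[cite: Federbush1988PhaseCellIV, Theorem A.3 (A.26), (A.31) p. 342] -/
theorem norm_iteratedFDeriv_comp_le_of_scale {Φ : Euc n → Euc t} {P : Euc t → Euc t} {s : Set (Euc n)} (hs : IsOpen s)
    {x : Euc n} (hx : x ∈ s) (hΦ : ContDiffOn ℝ ∞ Φ s) (hP : ContDiff ℝ ∞ P) {m : ℕ} (hm : 1 ≤ m)
    {C u U σ : ℝ} (hσ : 0 < σ) (hu : 0 ≤ u) (hU : u ≤ U) (hU1 : 1 ≤ U)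
    (hC : ∀ i ≤ m, ‖iteratedFDeriv ℝ i P (Φ x)‖ ≤ C)
    (hΦb : ∀ i, 1 ≤ i → i ≤ m → ‖iteratedFDeriv ℝ i Φ x‖ ≤ u * (σ⁻¹) ^ i) :
    ‖iteratedFDeriv ℝ m (P ∘ Φ) x‖ ≤ m.factorial * C * U ^ (m - 1) * u * (σ⁻¹) ^ m := by
  obtain ⟨ρ, hρ0, hρ, hρm⟩ := exists_root_scale hu hU hU1 hm
  have hC0 : 0 ≤ C := (norm_nonneg _).trans (hC 0 (Nat.zero_le m))
  have hsU : UniqueDiffOn ℝ s := hs.uniqueDiffOn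
  have key := norm_iteratedFDerivWithin_comp_le (t := univ) hP.contDiffOn hΦ (n := m) (mod_cast le_top) uniqueDiffOn_univ hsU
    (mapsTo_univ Φ s) hx (C := C) (D := σ⁻¹ * ρ) (fun i hi => by rw [iteratedFDerivWithin_univ]; exact hC i hi)
    (fun i hi1 hi => by
      rw [iteratedFDerivWithin_of_isOpen i hs hx, mul_pow]
      exact (hΦb i hi1 hi).trans (by rw [mul_comm]; exact mul_le_mul_of_nonneg_left (hρ i hi1 hi) (by positivity)))
  rw [iteratedFDerivWithin_of_isOpen m hs hx] at key
  calc ‖iteratedFDeriv ℝ m (P ∘ Φ) x‖ ≤ m.factorial * C * (σ⁻¹ * ρ) ^ m := key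
    _ = m.factorial * C * ρ ^ m * (σ⁻¹) ^ m := by rw [mul_pow]; ring
    _ ≤ m.factorial * C * (U ^ (m - 1) * u) * (σ⁻¹) ^ m := by gcongr
    _ = m.factorial * C * U ^ (m - 1) * u * (σ⁻¹) ^ m := by ring

/-! ## §3 Lipschitz extension of the datum and the degenerate dimension -/

/-- «view `f` as a map from `B` into `R^t`» and extend it to `ℝⁿ` keeping a Lipschitz bound (Mathlib's finite-dimensional
extension, constant `L_t·Λ₁(f)`). [cite: Federbush1988PhaseCellIV, proof of Theorem A.3 p. 342] -/
theorem exists_lipschitz_extension {M : Set (Euc t)} (f : ↥(closedBall (0 : Euc n) 1) → ↥M) {K : ℝ≥0}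
    (hf : LipschitzWith K f) : ∃ g : Euc n → Euc t, LipschitzWith (lipschitzExtensionConstant (Euc t) * K) g ∧
      ∀ x : ↥(closedBall (0 : Euc n) 1), g x = (f x : Euc t) := by
  classical
  set g₁ : Euc n → Euc t := fun x => if hx : x ∈ closedBall (0 : Euc n) 1 then (f ⟨x, hx⟩ : Euc t) else 0 with hg₁
  have hg₁L : LipschitzOnWith K g₁ (closedBall (0 : Euc n) 1) := by
    intro x hx y hy
    simp only [hg₁, dif_pos hx, dif_pos hy]
    have := (LipschitzWith.subtype_val M).comp hf
    rw [one_mul] at this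
    exact this.edist_le_mul ⟨x, hx⟩ ⟨y, hy⟩
  obtain ⟨g, hg, heq⟩ := hg₁L.extend_finite_dimension
  refine ⟨g, hg, fun x => ?_⟩
  have := heq x.2
  simp only [hg₁, dif_pos x.2] at this
  exact this.symm

/-- If the unit sphere of `ℝⁿ` is empty (`n = 0`) the space is a point and all derivatives of positive order vanish.
[cite: Federbush1988PhaseCellIV, Theorem A.3 (A.26) p. 342] -/
theorem iteratedFDeriv_eq_zero_of_sphere_empty (hS : ¬ (sphere (0 : Euc n) 1).Nonempty) (φ : Euc n → Euc t) {m : ℕ}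
    (hm : 1 ≤ m) (x : Euc n) : iteratedFDeriv ℝ m φ x = 0 := by
  have hzero : ∀ y : Euc n, y = 0 := by
    intro y
    by_contra hy
    have hny : 0 < ‖y‖ := norm_pos_iff.2 hy
    exact hS ⟨‖y‖⁻¹ • y, by rw [mem_sphere, dist_zero_right, norm_smul, norm_inv, norm_norm, inv_mul_cancel₀ hny.ne']⟩
  haveI : Nonempty (Fin m) := ⟨⟨0, hm⟩⟩
  ext v
  have hv : v = 0 := funext fun i => hzero (v i)
  rw [hv]
  simp

/-! ## §4 Theorem A.3 (capped form) for uniformly smoothly retractable targets -/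

/-- **Theorem A.3 of [Federbush1988PhaseCellIV] (decl of record `ThmA3ContCap`, with the p. 339 «Caution» cap) for every target
`M ⊆ R^t` that is a uniform smooth neighbourhood retract**: given `r > 0` and a `C^∞` map `P : R^t → R^t` with `P(y) ∈ M` for
`d(y, M) < r`, `P = id` on `M` and `‖D^iP‖ ≤ C_i` on `{d(·, M) < r}` (print: «`Pr_M` is the projection onto `M`, using the
normal bundle to `M`, and defined in a neighborhood of `M`» — for a compact `C^∞` submanifold this is the tubular-neighbourhood
theorem), for every cap `c₁` there are constants `c_m` such that every `f : B → M` with `Λ₁(f) ≤ c₁` has `f^s = P ∘ f^{s′}`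
with (A.25) `f^s = f` on `∂B`, `f^s` continuous on `B`, `C^∞` inside, and (A.26) `‖D^m f^s(x)‖ ≤ c_m d(x, ∂B)^{−(m−1)} Λ₁(f)`.
[cite: Federbush1988PhaseCellIV, Theorem A.3 (A.25)–(A.26), (A.27)–(A.31) p. 342; «Caution» p. 339] -/
theorem thmA3ContCap_of_retract {M : Set (EuclideanSpace ℝ (Fin t))} {P : EuclideanSpace ℝ (Fin t) → EuclideanSpace ℝ (Fin t)}
    {r : ℝ} (hr : 0 < r) (hP : ContDiff ℝ ∞ P) (hPM : ∀ y, infDist y M < r → P y ∈ M) (hPid : ∀ y ∈ M, P y = y)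
    (hPb : ∀ i : ℕ, ∃ C : ℝ, ∀ y, infDist y M < r → ‖iteratedFDeriv ℝ i P y‖ ≤ C) (n : ℕ) :
    ThmA3ContCap n t M := by
  intro c₁
  -- constants
  set L : ℝ≥0 := lipschitzExtensionConstant (Euc t) with hL
  set ε : ℝ := min (1 / 4) (r / (8 * (L * c₁ + 1))) with hε_def
  have hε : 0 < ε := lt_min (by norm_num) (by positivity)
  have hε4 : ε ≤ 1 / 4 := min_le_left _ _
  have hεr : 4 * ε * (L * c₁) < r := by
    have h1 : ε ≤ r / (8 * (L * c₁ + 1)) := min_le_right _ _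
    have h2 : 4 * ε * (L * c₁) ≤ 4 * (r / (8 * (L * c₁ + 1))) * (L * c₁) := by gcongr
    have h3 : 4 * (r / (8 * (L * c₁ + 1))) * (L * c₁) < r := by
      rw [show 4 * (r / (8 * (L * c₁ + 1))) * (L * c₁) = r * (L * c₁ / (2 * (L * c₁ + 1))) by field_simp; ring]
      have : (L * c₁ : ℝ) / (2 * (L * c₁ + 1)) < 1 := by
        rw [div_lt_one (by positivity)]; nlinarith [L.coe_nonneg, c₁.coe_nonneg, mul_nonneg L.coe_nonneg c₁.coe_nonneg]
      nlinarith
    exact lt_of_le_of_lt h2 h3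
  have hA : ∀ m : ℕ, ∃ A : ℝ, 0 ≤ A ∧ ∀ (g : Euc n → Euc t) (K : ℝ≥0), LipschitzWith K g → ∀ i, 1 ≤ i → i ≤ m →
      ∀ x ∈ ball (0 : Euc n) 1, ‖iteratedFDeriv ℝ i (smooth ε g) x‖ ≤ A * K * ((theta x)⁻¹) ^ (i - 1) :=
    fun m => exists_deriv_bound m hε
  choose A hA0 hA using hA
  choose Cf hCf using hPb
  set Cmax : ℕ → ℝ := fun m => ∑ i ∈ Finset.range (m + 1), max (Cf i) 0 with hCmax
  have hCmax_ge : ∀ m i, i ≤ m → Cf i ≤ Cmax m := fun m i hi =>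
    (le_max_left _ _).trans (Finset.single_le_sum (f := fun i => max (Cf i) 0) (fun i _ => le_max_right _ _)
      (by rw [Finset.mem_range]; omega))
  set U : ℕ → ℝ := fun m => max 1 (A m * (L * c₁)) with hU
  refine ⟨fun m => m.factorial * Cmax m * U m ^ (m - 1) * (A m * L), fun f hf => ?_⟩
  obtain ⟨K₀, hK₀c, hK₀⟩ := hf
  obtain ⟨g, hgL, hgf⟩ := exists_lipschitz_extension f hK₀
  -- the smoothed map `f^{s′}` and `f^s = P ∘ f^{s′}`
  set fs' : Euc n → Euc t := smooth ε g with hfs'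
  have hclose : ∀ x ∈ closedBall (0 : Euc n) 1, infDist (fs' x) M < r := by
    intro x hx
    have hgx : g x ∈ M := by rw [hgf ⟨x, hx⟩]; exact (f ⟨x, hx⟩).2
    have h1 : infDist (fs' x) M ≤ dist (fs' x) (g x) := infDist_le_dist_of_mem hgx
    have h2 : dist (fs' x) (g x) ≤ 4 * ε * (L * K₀) * max (theta x) 0 := by
      rw [dist_eq_norm]; exact norm_smooth_sub_le' hε hgL x
    have h3 : max (theta x) 0 ≤ 1 := max_le (theta_le_one x) zero_le_one
    have h4 : 4 * ε * ((L : ℝ) * K₀) * max (theta x) 0 ≤ 4 * ε * (L * c₁) * 1 := by gcongr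
    linarith
  refine ⟨P ∘ fs', fun x hx => hPM _ (hclose x hx), fun x => ?_, ?_, ?_, fun m hm K hKc hK x hx => ?_⟩
  · -- (A.25) boundary values
    show P (smooth ε g x) = _
    rw [smooth_eq_on_sphere x.2, hgf ⟨x.1, sphere_subset_closedBall x.2⟩]
    exact hPid _ (f _).2
  · -- continuity on the closed ball
    exact (hP.continuous.comp (continuous_smooth hε hgL)).continuousOn
  · -- smoothness inside
    exact hP.comp_contDiffOn (contDiffOn_smooth hgL.continuous)
  · -- (A.26)
    have hCmax0 : 0 ≤ Cmax m := Finset.sum_nonneg fun i _ => le_max_right _ _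
    have hU0 : 0 ≤ U m := le_trans zero_le_one (le_max_left _ _)
    have hc0 : 0 ≤ (m.factorial : ℝ) * Cmax m * U m ^ (m - 1) * (A m * L) := by
      have := hA0 m
      positivity
    by_cases hS : (sphere (0 : Euc n) 1).Nonempty
    · -- re-extend with the constant `K` of the clause and use locality
      obtain ⟨g', hg'L, hg'f⟩ := exists_lipschitz_extension f hK
      have heqOn : EqOn g g' (closedBall (0 : Euc n) 1) := fun y hy => by rw [hgf ⟨y, hy⟩, hg'f ⟨y, hy⟩]
      have hev : (P ∘ fs') =ᶠ[𝓝 x] (P ∘ smooth ε g') := by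
        filter_upwards [smooth_eventuallyEq_of_eqOn hε hε4 heqOn hx] with y hy
        simp only [comp_apply, hfs', hy]
      rw [(hev.iteratedFDeriv ℝ m).eq_of_nhds]
      -- the chain-rule bound
      have hθ : 0 < theta x := theta_pos hx
      have hxc : x ∈ closedBall (0 : Euc n) 1 := ball_subset_closedBall hx
      have hPt : ∀ i ≤ m, ‖iteratedFDeriv ℝ i P (smooth ε g' x)‖ ≤ Cmax m := by
        intro i hi
        refine (hCf i _ ?_).trans (hCmax_ge m i hi)
        have : smooth ε g' x = fs' x := (smooth_congr_of_eqOn hε hε4 heqOn hxc).symm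
        rw [this]; exact hclose x hxc
      have hΦb : ∀ i, 1 ≤ i → i ≤ m →
          ‖iteratedFDeriv ℝ i (smooth ε g') x‖ ≤ (A m * (L * K) * theta x) * ((theta x)⁻¹) ^ i := by
        intro i hi1 hi
        refine (hA m g' (L * K) hg'L i hi1 hi x hx).trans (le_of_eq ?_)
        obtain ⟨k, rfl⟩ := Nat.exists_eq_add_of_le' hi1
        rw [Nat.add_sub_cancel, pow_succ, NNReal.coe_mul]
        field_simp
      have hu0 : 0 ≤ A m * (L * K) * theta x := by have := hA0 m; positivity
      have huU : A m * (L * K) * theta x ≤ U m := by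
        refine le_trans ?_ (le_max_right _ _)
        calc A m * (L * K) * theta x ≤ A m * (L * c₁) * 1 := by
              have := hA0 m; have := theta_le_one x; gcongr
          _ = A m * (L * c₁) := mul_one _
      have key := norm_iteratedFDeriv_comp_le_of_scale isOpen_ball hx (contDiffOn_smooth hg'L.continuous) hP hm hθ hu0 huU
        (le_max_left _ _) hPt hΦb
      -- compare `θ(x)^{-(m-1)}` with `d(x, ∂B)^{-(m-1)}`
      have hd0 : 0 < infDist x (sphere (0 : Euc n) 1) :=
        ((isClosed_sphere.notMem_iff_infDist_pos hS).1 (by rw [mem_sphere]; rw [mem_ball] at hx; exact ne_of_lt hx))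
      have hdθ : (theta x)⁻¹ ≤ (infDist x (sphere (0 : Euc n) 1))⁻¹ :=
        (inv_le_inv₀ hθ hd0).2 (infDist_sphere_le_theta hxc)
      obtain ⟨k, rfl⟩ := Nat.exists_eq_add_of_le' hm
      rw [Nat.add_sub_cancel] at key ⊢
      have hθ0 : theta x ≠ 0 := hθ.ne'
      have hc0' : 0 ≤ ((k + 1).factorial : ℝ) * Cmax (k + 1) * U (k + 1) ^ k * (A (k + 1) * L) := by
        have := hA0 (k + 1)
        positivity
      calc ‖iteratedFDeriv ℝ (k + 1) (P ∘ smooth ε g') x‖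
          ≤ (k + 1).factorial * Cmax (k + 1) * U (k + 1) ^ k * (A (k + 1) * (L * K) * theta x) * ((theta x)⁻¹) ^ (k + 1) :=
            key
        _ = (k + 1).factorial * Cmax (k + 1) * U (k + 1) ^ k * (A (k + 1) * L) * ((theta x)⁻¹) ^ k * K := by
            rw [pow_succ]; field_simp
        _ ≤ (k + 1).factorial * Cmax (k + 1) * U (k + 1) ^ k * (A (k + 1) * L) *
              ((infDist x (sphere (0 : Euc n) 1))⁻¹) ^ k * K :=
            mul_le_mul_of_nonneg_right
              (mul_le_mul_of_nonneg_left (pow_le_pow_left₀ (inv_nonneg.2 hθ.le) hdθ k) hc0') K.coe_nonneg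
    · -- degenerate dimension: no unit sphere, the space is a point, derivatives vanish
      rw [iteratedFDeriv_eq_zero_of_sphere_empty hS _ hm, norm_zero]
      exact mul_nonneg (mul_nonneg hc0 (pow_nonneg (inv_nonneg.2 infDist_nonneg) _)) K.coe_nonneg

end Retract

end PhaseCellIVAppA

end

end Literature.MathematicalPhysics.QuantumFieldTheory.Federbush1986
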